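import Summits.BirchSwinnertonDyer.Rank1Residual.GaloisImage.PropagatedConditionTopOfNoTorsion
import Summits.BirchSwinnertonDyer.Rank1Residual.GaloisImage.PropagatedStructure
import Literature.NumberTheory.EllipticCurves.KummerSequenceConnecting
import Literature.NumberTheory.EllipticCurves.SelmerProofs
import HarnessLib

/-!
# [MR04] Lemma A.1 for `E/ℚ` at ANY prime `p`, every level: `E(ℚ_p)[p] = 0 ⇒ 𝓕_can(E[p^{k+1}])_{(p)} = H¹(ℚ_p, E[p^{k+1}])`
# (the generic-prime form of n1011's F12 `PropagatedConditionTopOfNoTorsionThree`; cell `b2b-bsdres`, seat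
# `b2b-bsdres-additive-p3` GEN 42 for the ladder-BSD K3 hand `bsd-ssimc`; file F36)

HONEST FRAMING (cell `b2b-bsdres`, run/shared/lean/b2b/bsd-rank1-residual/, verbatim in every
file): the goal of the cell is to DELETE the COMBINATION-SHAPED residual classes of the
Birch–Swinnerton-Dyer formula for ALL analytic-rank `≤ 1` elliptic curves over `ℚ` — "full BSD
formula for every rank `≤ 1` curve in class `C`" assembled STRICTLY from published theorems — so
that the rank-`≤ 1` remainder becomes exactly the CONSTRUCTION-SHAPED classes, which are TYPED
(missing-input `Prop`s), NOT attempted. This is not "finishing BSD". TOOL theorems only (no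
definition, no named fact, no `sorry`); nothing booked; no label / mark / flag text moves; X7 / X8 stay
CONSTRUCTION-SHAPED and the cell conjecture C-16 / the depth law stay CONJECTURES.

## What

n1011's F11 (`propagatedSelmerStructureOne_eq_top_of_torsion_eq_zero`) is Mazur–Rubin's Lemma A.1 at
LEVEL ONE for any prime `p`; n1011's F12 (`propagatedSelmerStructure_three_eq_top_of_torsion_eq_zero`)
climbs the levels `E[3^k·3]` by the dévissage `0 → E[3] → E[3^{k+1}·3] →(·3) E[3^k·3] → 0`, but is
spelled with the numeral `3` (its level-`0` step and its dévissage use the kernel identity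
`3^0·3 = 3`).  This file is the SAME argument at a generic prime `p`, which the generic-prime LAW-2 /
THEOREM D consumers (`Ordinary/Conjectures/KolyvaginKimDatumOfEulerSystemAnyPrime.lean`, hypothesis
`htop : 𝓕_can,p = ⊤`) need:

* `TransportPrime.localMap_torsionInclusion_tateLocalMap`, `TransportPrime.localMap_red_tateLocalMap` —
  the generic-`p` forms of n1011-p11's local transport formulas `incl_* (π_{k+1})_* = (π_{k'+1})_* ∘ p^{k'−k}`,
  `red_* (π_{k'+1})_* = (π_{k+1})_*` on `H¹(ℚ_v, T_pE)` (transition maps of the Tate module);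
* `TorsionLevelPrime.isSES_torsionInclusion_red` — `0 → E[p^0·p] → E[p^{k+1}·p] →(red) E[p^k·p] → 0` is a
  short exact sequence of discrete `Γ_ℚ`-modules for any equivariant `red` acting as `x ↦ p·x`
  (first term spelled at level `0`, so that no numeral identity is needed downstream);
* `propagatedRelaxed_eq_top_of_torsion_eq_zero_of_level_eq` — F11 transported to ANY spelling `n = p`
  of the level (the level-`0` structure `𝓕_can(E[p^0·p])` is F11's `𝓕_can(E[p])` along `p^0·p = p`);
* **`propagatedSelmerStructure_eq_top_of_torsion_eq_zero`** — for every prime `p`, every place `v ∋ p`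
  with `E(ℚ_v)[p] = 0`, every reduction tower `red_k : E[p^{k+1}·p] → E[p^k·p]` (`x ↦ p·x`) and every
  `k`: `𝓕_can(E[p^k·p])_{(v)} = ⊤`; consequence `mem_propagatedSelmerStructure_of_torsion_eq_zero`.

The proof of the main theorem is F12's, letter for letter, with `3 ↦ p` and the level-`0` step
supplied by the transport lemma instead of the numeral identity.

References: B. Mazur, K. Rubin, Mem. AMS 799 (2004), App. A, Lemma A.1 (p. 79), Thm. 3.2.4;
K. Rubin, PCMS 18 (2011), §3.1, Thm. 4.3.1 (2); J.-P. Serre, *Galois Cohomology*, I §2.2;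
J. S. Milne, *ADT* (2006) I §6 (`0 → A_m → A_{mn} → A_n → 0`).
-/

noncomputable section

open scoped Classical NumberField ContRepresentation
open Field NumberField IsDedekindDomain Function
open WeierstrassCurve Literature.NumberTheory.EllipticCurves Literature.NumberTheory.GaloisRepresentations
  Literature.NumberTheory.GaloisRepresentations.DiscreteGaloisModule Literature.NumberTheory.GaloisCohomology

/-! ### §1 Local transport formulas at a generic prime (n1011-p11's `Transport`, `3 ↦ p`) -/

namespace Summit.BirchSwinnertonDyer.Rank1Residual.GaloisImage.TransportPrime

variable (W : WeierstrassCurve ℚ) [W.IsElliptic] (p : ℕ) [hp : Fact p.Prime] {k k' : ℕ}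

/-- **`incl_* ∘ (π_{k+1})_* = (π_{k'+1})_* ∘ p^{k'−k}` locally**: on a crossed homomorphism
`η : Γ_{ℚ_v} → T_pE`, `incl (π_{k+1} η) = π_{k'+1} (p^{k'−k} η)` (the transition maps of the Tate
module, `TateModule.pow_smul_proj_self_add`; n1011-p11's formula at `p = 3`). [folklore] -/
theorem localMap_torsionInclusion_tateLocalMap (hk : k ≤ k') (v : Place ℚ)
    (η : contOneCocycles (tateLocalRep W p v).toTopRep) :
    DiscreteGaloisModule.localMap (W.torsionInclusion (mul_dvd_mul_right (pow_dvd_pow (p : ℤ) hk) (p : ℤ))) v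
        (tateLocalMap W p k v (oneCocycleClass (tateLocalRep W p v).toTopRep η)) =
      tateLocalMap W p k' v
        (oneCocycleClass (tateLocalRep W p v).toTopRep ((((p ^ (k' - k) : ℕ)) : ℤ) • η)) := by
  rw [tateLocalMap_oneCocycleClass, tateLocalMap_oneCocycleClass]
  erw [galoisCohomology.map_one_oneCocycleClass]
  congr 1
  apply Subtype.ext
  apply ContinuousMap.ext
  intro σ
  apply Subtype.ext
  show ((W.torsionInclusion (mul_dvd_mul_right (pow_dvd_pow (p : ℤ) hk) (p : ℤ)) (tateToTorsion W p k (η.1 σ)) :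
      geomTorsion W ((p : ℤ) ^ k' * (p : ℤ))) : geomPoints W) =
    ((tateToTorsion W p k' ((((p ^ (k' - k) : ℕ)) : ℤ) • η.1 σ) :
      geomTorsion W ((p : ℤ) ^ k' * (p : ℤ))) : geomPoints W)
  rw [coe_torsionInclusion_apply, coe_tateToTorsion_apply, coe_tateToTorsion_apply, map_zsmul,
    natCast_zsmul, show k' + 1 = (k' - k) + (k + 1) by omega]
  exact (TateModule.pow_smul_proj_self_add (k' - k) (k + 1) (η.1 σ)).symm

/-- **`red_* ∘ (π_{k'+1})_* = (π_{k+1})_*` locally** when `red` is `x ↦ p^{k'−k} x` on points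
(n1011-p11's formula at `p = 3`). [folklore] -/
theorem localMap_red_tateLocalMap (hk : k ≤ k')
    (red : (W.torsionGaloisModule ((p : ℤ) ^ k' * (p : ℤ))).toContRepresentation →ⁱL
      (W.torsionGaloisModule ((p : ℤ) ^ k * (p : ℤ))).toContRepresentation)
    (hred : ∀ x : geomTorsion W ((p : ℤ) ^ k' * (p : ℤ)),
      ((red x : geomTorsion W ((p : ℤ) ^ k * (p : ℤ))) : geomPoints W) =
        ((p : ℤ) ^ (k' - k)) • (x : geomPoints W))
    (v : Place ℚ) (η : contOneCocycles (tateLocalRep W p v).toTopRep) :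
    DiscreteGaloisModule.localMap red v
        (tateLocalMap W p k' v (oneCocycleClass (tateLocalRep W p v).toTopRep η)) =
      tateLocalMap W p k v (oneCocycleClass (tateLocalRep W p v).toTopRep η) := by
  rw [tateLocalMap_oneCocycleClass, tateLocalMap_oneCocycleClass]
  erw [galoisCohomology.map_one_oneCocycleClass]
  congr 1
  apply Subtype.ext
  apply ContinuousMap.ext
  intro σ
  apply Subtype.ext
  show ((red (tateToTorsion W p k' (η.1 σ)) :
      geomTorsion W ((p : ℤ) ^ k * (p : ℤ))) : geomPoints W) =
    ((tateToTorsion W p k (η.1 σ) : geomTorsion W ((p : ℤ) ^ k * (p : ℤ))) : geomPoints W)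
  rw [hred, coe_tateToTorsion_apply, coe_tateToTorsion_apply, ← Nat.cast_pow, natCast_zsmul,
    show k' + 1 = (k' - k) + (k + 1) by omega]
  exact TateModule.pow_smul_proj_self_add (k' - k) (k + 1) (η.1 σ)

end Summit.BirchSwinnertonDyer.Rank1Residual.GaloisImage.TransportPrime

/-! ### §2 The dévissage `0 → E[p^0·p] → E[p^{k+1}·p] →(·p) E[p^k·p] → 0` at a generic prime -/

namespace Summit.BirchSwinnertonDyer.Rank1Residual.GaloisImage.TorsionLevelPrime

variable (W : WeierstrassCurve ℚ) [W.IsElliptic] (p : ℕ) [hp : Fact p.Prime] (k : ℕ)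
  (red : (W.torsionGaloisModule ((p : ℤ) ^ (k + 1) * (p : ℤ))).toContRepresentation →ⁱL
    (W.torsionGaloisModule ((p : ℤ) ^ k * (p : ℤ))).toContRepresentation)
  (hred : ∀ x : geomTorsion W ((p : ℤ) ^ (k + 1) * (p : ℤ)),
    ((red x : geomTorsion W ((p : ℤ) ^ k * (p : ℤ))) : geomPoints W) = (p : ℤ) • (x : geomPoints W))

omit [W.IsElliptic] in
include hred in
/-- **`0 → E[p^0·p] →(incl) E[p^{k+1}·p] →(red) E[p^k·p] → 0` is a short exact sequence of discrete
`Γ_ℚ`-modules** for any prime `p` and any equivariant `red` which is `x ↦ p·x` on points (surjectivity =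
divisibility of `E(ℚ̄)`); the first term is spelled at level `0` (`E[p^0·p] = E[p]`), the inclusion
`E[p^0·p] ⊆ E[p^{k+1}·p]` taken along the divisibility `p^0·p ∣ p^{k+1}·p` written as the term
`mul_dvd_mul_right (pow_dvd_pow p _) p` (the spelling of bsd-addord's `pow_mul_dvd_pow_mul_of_le`). Milne's `0 → A_m → A_{mn} →ᵐ A_n → 0`;
n1011-p11's `TorsionLevel.isSES_torsionInclusion_red` at `p = 3`.
[cite: MilneADT2006, Ch. I §6, proof of Prop. 6.9] -/
theorem isSES_torsionInclusion_red :
    IsSES (DiscreteGaloisModule.homOfIntertwining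
        (W.torsionInclusion (mul_dvd_mul_right (pow_dvd_pow (p : ℤ) (Nat.zero_le (k + 1))) (p : ℤ))))
      (DiscreteGaloisModule.homOfIntertwining red) where
  comp_eq_zero := by
    ext P
    have h0 := (mem_geomTorsion_iff W ((p : ℤ) ^ 0 * (p : ℤ)) _).mp P.2
    have e : ((p : ℤ) ^ 0 * (p : ℤ)) = (p : ℤ) := by rw [pow_zero, one_mul]
    have h : (p : ℤ) • (P : geomPoints W) = 0 :=
      (congrArg (fun t : ℤ => t • (P : geomPoints W)) e).symm.trans h0
    change ((red (W.torsionInclusion (mul_dvd_mul_right (pow_dvd_pow (p : ℤ) (Nat.zero_le (k + 1))) (p : ℤ)) P) :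
      geomTorsion W ((p : ℤ) ^ k * (p : ℤ))) : geomPoints W) = 0
    rw [hred, coe_torsionInclusion_apply]
    exact h
  injective := fun P Q h => Subtype.ext (congrArg Subtype.val h :)
  exact_mid := fun P hP => by
    have hP' : (p : ℤ) • (P : geomPoints W) = 0 := by
      rw [← hred]
      exact congrArg Subtype.val hP
    have hP'' : ((p : ℤ) ^ 0 * (p : ℤ)) • (P : geomPoints W) = 0 := by
      rwa [pow_zero, one_mul]
    exact ⟨⟨P, (mem_geomTorsion_iff W _ _).mpr hP''⟩, rfl⟩
  surjective := fun Q => by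
    have hp0 : (p : ℤ) ≠ 0 := by exact_mod_cast hp.out.ne_zero
    obtain ⟨P, hP⟩ := W.zsmul_geomPoints_surjective_of_charZero hp0 (Q : geomPoints W)
    have hP' : (p : ℤ) • P = (Q : geomPoints W) := hP
    have hPmem : P ∈ geomTorsion W ((p : ℤ) ^ (k + 1) * (p : ℤ)) := by
      rw [mem_geomTorsion_iff, mul_zsmul, hP', pow_succ]
      exact (mem_geomTorsion_iff W _ _).mp Q.2
    refine ⟨⟨P, hPmem⟩, Subtype.ext ?_⟩
    change ((red ⟨P, hPmem⟩ : geomTorsion W ((p : ℤ) ^ k * (p : ℤ))) : geomPoints W) =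
      (Q : geomPoints W)
    rw [hred]
    exact hP'

end Summit.BirchSwinnertonDyer.Rank1Residual.GaloisImage.TorsionLevelPrime

/-! ### §3 Lemma A.1 at every level, generic prime -/

namespace Summit.BirchSwinnertonDyer.Rank1Residual.GaloisImage

variable (W : WeierstrassCurve ℚ) [W.IsElliptic] (p : ℕ) [hp : Fact p.Prime]

/-- **F11 along any spelling of the level.** For every integer `n` EQUAL to `p` and every proof that
`a ↦ a_1` lands in `E[n]`, the canonical condition propagated from `T_pE` through `π_1 : T_pE → E[n]` is
all of `H¹(ℚ_v, E[n])` as soon as `E(ℚ_v)[p] = 0` (`v ∋ p`): after substituting `n = p` this IS n1011's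
F11 `propagatedSelmerStructureOne_eq_top_of_torsion_eq_zero` (the two Bloch–Kato data agree
definitionally). Used at `n = p^0·p`, the level-`0` spelling of `propagatedSelmerStructure W p 0`.
[cite: MazurRubin2004, App. A, Lemma A.1 (p. 79)] -/
theorem propagatedRelaxed_eq_top_of_torsion_eq_zero_of_level_eq (n : ℤ) (hn : n = (p : ℤ))
    (hmem : ∀ a : W.tateModule p, TateModule.proj p 1 a ∈ geomTorsion W n)
    (v : HeightOneSpectrum (𝓞 ℚ)) (hv : ((p : ℕ) : 𝓞 ℚ) ∈ v.asIdeal)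
    (htors : ∀ P : (W.baseChange (v.adicCompletion ℚ)).toAffine.Point, p • P = 0 → P = 0) :
    (({ repV := (W.tateGaloisRep p (W.continuous_galoisRepTate_holds p)).toIntRep
        repW := W.torsionGaloisModule n
        proj := (TateModule.proj p 1).codRestrict _ hmem
        continuous_proj := (TateModule.continuous_proj 1).subtype_mk _
        proj_apply := fun _ _ => Subtype.ext rfl } :
        BlochKatoDatum ℚ (W.tateModule p) (geomTorsion W n)).propagatedRelaxed (Sum.inr v : Place ℚ)) = ⊤ := by
  subst hn
  exact propagatedSelmerStructureOne_eq_top_of_torsion_eq_zero W p v hv htors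

/-- **[MR04] Lemma A.1 for `E/ℚ` at ANY prime `p`, every level**: if `E(ℚ_v)[p] = 0` at the place
`v ∋ p` then `𝓕_can(E[p^k·p])_{(v)} = ⊤` for every `k` — induction on `k` from the level-one count
(F11, transported to the level-`0` spelling) and the dévissage `0 → E[p^0·p] → E[p^{k+1}·p] → E[p^k·p] → 0`,
no `H²`; n1011's F12 at `p = 3`, letter for letter. The reduction maps `red_k : E[p^{k+1}·p] → E[p^k·p]`
(multiplication by `p`) are parameters with their specification `hred` (a tower exists for every curve:
`Ordinary.exists_torsionReductionTower`). [cite: MazurRubin2004, App. A, Lemma A.1 (p. 79)] -/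
theorem propagatedSelmerStructure_eq_top_of_torsion_eq_zero (v : HeightOneSpectrum (𝓞 ℚ))
    (hv : ((p : ℕ) : 𝓞 ℚ) ∈ v.asIdeal)
    (htors : ∀ P : (W.baseChange (v.adicCompletion ℚ)).toAffine.Point, p • P = 0 → P = 0)
    (red : ∀ k : ℕ, (W.torsionGaloisModule ((p : ℤ) ^ (k + 1) * (p : ℤ))).toContRepresentation →ⁱL
      (W.torsionGaloisModule ((p : ℤ) ^ k * (p : ℤ))).toContRepresentation)
    (hred : ∀ (k : ℕ) (x : geomTorsion W ((p : ℤ) ^ (k + 1) * (p : ℤ))),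
      ((red k x : geomTorsion W ((p : ℤ) ^ k * (p : ℤ))) : geomPoints W) =
        (p : ℤ) • (x : geomPoints W))
    (k : ℕ) : propagatedSelmerStructure W p k (Sum.inr v) = ⊤ := by
  set V : Place ℚ := Sum.inr v with hV
  -- level `0` (`𝓕_can(E[p^0·p]) = ⊤`): F11 transported along `p^0·p = p`
  have h0 : propagatedSelmerStructure W p 0 V = ⊤ :=
    propagatedRelaxed_eq_top_of_torsion_eq_zero_of_level_eq W p ((p : ℤ) ^ 0 * (p : ℤ))
      (by rw [pow_zero, one_mul]) (proj_succ_mem_geomTorsion W p 0) v hv htors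
  induction k with
  | zero => exact h0
  | succ k ih =>
    rw [eq_top_iff]
    intro z _
    -- `red_* z ∈ 𝓕_can(k) = ⊤`: `red_* z = π_{k+1,*}[η]`
    have hz : localMap (red k) V z ∈ propagatedSelmerStructure W p k V := by
      rw [ih]; exact AddSubgroup.mem_top _
    obtain ⟨y, hy⟩ := (mem_propagatedSelmerStructure_iff W p k V _).mp hz
    obtain ⟨η, rfl⟩ := oneCocycleClass_surjective (tateLocalRep W p V).toTopRep y
    -- `red_* π_{k+2,*}[η] = π_{k+1,*}[η]`
    have hredpow : ∀ x : geomTorsion W ((p : ℤ) ^ (k + 1) * (p : ℤ)),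
        ((red k x : geomTorsion W ((p : ℤ) ^ k * (p : ℤ))) : geomPoints W) =
          ((p : ℤ) ^ ((k + 1) - k)) • (x : geomPoints W) := fun x => by
      rw [hred, Nat.add_sub_cancel_left, pow_one]
    have hcomp := TransportPrime.localMap_red_tateLocalMap W p (Nat.le_succ k) (red k) hredpow V η
    -- the difference is killed by `red_*`
    set z₁ := tateLocalMap W p (k + 1) V (oneCocycleClass (tateLocalRep W p V).toTopRep η) with hz₁
    have hdiff : localMap (red k) V (z - z₁) = 0 := by
      rw [map_sub, hz₁, hcomp, hy, sub_self]
    -- exactness at the middle of the local short exact sequence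
    have hSES := (TorsionLevelPrime.isSES_torsionInclusion_red W p k (red k) (hred k)).restrictField
      (Place.Completion V)
    obtain ⟨w, hw⟩ := hSES.exists_map_one_eq_of_map_one_eq_zero (z - z₁) hdiff
    -- `w ∈ H¹(ℚ_v, E[p^0·p]) = 𝓕_can(0)`: `w = π_{1,*}[η′]`
    have hw0 : w ∈ propagatedSelmerStructure W p 0 V := by
      rw [h0]; exact AddSubgroup.mem_top _
    obtain ⟨y', hy'⟩ := (mem_propagatedSelmerStructure_iff W p 0 V _).mp hw0
    obtain ⟨η', rfl⟩ := oneCocycleClass_surjective (tateLocalRep W p V).toTopRep y'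
    -- `incl_* π_{1,*}[η′] = π_{k+2,*}[p^{k+1} η′]`
    have hincl := TransportPrime.localMap_torsionInclusion_tateLocalMap W p (Nat.zero_le (k + 1)) V η'
    -- `z = z₁ + incl_* w ∈ 𝓕_can(k+1)`
    have hzeq : z = z₁ + localMap (W.torsionInclusion
        (mul_dvd_mul_right (pow_dvd_pow (p : ℤ) (Nat.zero_le (k + 1))) (p : ℤ))) V
        (tateLocalMap W p 0 V (oneCocycleClass (tateLocalRep W p V).toTopRep η')) := by
      rw [hy']
      have hw' : localMap (W.torsionInclusion
          (mul_dvd_mul_right (pow_dvd_pow (p : ℤ) (Nat.zero_le (k + 1))) (p : ℤ))) V w = z - z₁ := hw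
      rw [hw', add_sub_cancel]
    rw [hzeq, hincl]
    refine add_mem ?_ ?_
    · exact (mem_propagatedSelmerStructure_iff W p (k + 1) V _).mpr ⟨_, rfl⟩
    · exact (mem_propagatedSelmerStructure_iff W p (k + 1) V _).mpr ⟨_, rfl⟩

/-- **THEOREM B of row T-DER at `v = p` under the certificate `E(ℚ_p)[p] = 0`, any prime, any level**:
EVERY class of `H¹(ℚ_v, E[p^k·p])` — in particular the localisation at `p` of Kolyvagin's derivative
class `κ_r` — lies in `𝓕_can(E[p^k·p])_{(v)}` ([MR04] Thm. 3.2.4, second half / Remark A.5).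
[cite: MazurRubin2004, App. A, Lemma A.1 (p. 79)] -/
theorem mem_propagatedSelmerStructure_of_torsion_eq_zero (v : HeightOneSpectrum (𝓞 ℚ))
    (hv : ((p : ℕ) : 𝓞 ℚ) ∈ v.asIdeal)
    (htors : ∀ P : (W.baseChange (v.adicCompletion ℚ)).toAffine.Point, p • P = 0 → P = 0)
    (red : ∀ k : ℕ, (W.torsionGaloisModule ((p : ℤ) ^ (k + 1) * (p : ℤ))).toContRepresentation →ⁱL
      (W.torsionGaloisModule ((p : ℤ) ^ k * (p : ℤ))).toContRepresentation)
    (hred : ∀ (k : ℕ) (x : geomTorsion W ((p : ℤ) ^ (k + 1) * (p : ℤ))),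
      ((red k x : geomTorsion W ((p : ℤ) ^ k * (p : ℤ))) : geomPoints W) =
        (p : ℤ) • (x : geomPoints W))
    (k : ℕ) (x : galoisCohomology ((W.torsionGaloisModule ((p : ℤ) ^ k * (p : ℤ))).toLocal
      (Sum.inr v : Place ℚ)) 1) :
    x ∈ propagatedSelmerStructure W p k (Sum.inr v) := by
  rw [propagatedSelmerStructure_eq_top_of_torsion_eq_zero W p v hv htors red hred k]
  exact AddSubgroup.mem_top x

end Summit.BirchSwinnertonDyer.Rank1Residual.GaloisImage

end
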